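import Mathlib
import Literature.Topology.PlaneTopology.WindingNumber
import Literature.Analysis.Complex.LoopIndex
import Literature.Analysis.Complex.LogDerivZerosDisc
import HarnessLib

/-!
# The argument principle in winding-number form (inequality version)

For `H` holomorphic on a disc `‖z‖ < ρ` with no zero on the circle `‖z‖ = r < ρ`, the winding
number of the loop `H ∘ γ` along that circle (`Literature.Topology.PlaneTopology.wind`,
`circleLoop`) is the number of zeros of `H` inside, counted with multiplicity; in particular it is
`≥ 0`, and `> 0` as soon as `H` has a zero inside the circle (Conway, *Functions of One Complex
Variable I*, Ch. V Thm 3.4 / Ch. VII; here in the topological-winding-number language of the tree).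

* `wind_circleLoop_nonneg` — `0 ≤ wind (H ∘ γ)`;
* `wind_circleLoop_pos_of_zero` — a zero inside forces `0 < wind (H ∘ γ)`
  (`wind_circleLoop_ne_zero_of_zero`: `≠ 0`);
* `wind_circleLoop_pos_of_zero_of_center` — the same for circles `‖z - z₀‖ = r` inside a disc
  `B(z₀, ρ)` of holomorphy.

Proof (namespace `ArgPrinciple`): divide out the zeros of `H` in the closed disc `‖z‖ ≤ r`
(Mathlib's `MeromorphicOn.extract_zeros_poles`), `H = (∏_{u ∈ S} (z - u)^{n u}) · g` with `g`
holomorphic and zero-free on `‖z‖ ≤ r` (`factorisation`); then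
`wind (H ∘ γ) = ∑_{u ∈ S} n u + wind (g ∘ γ)` (`wind_mul`, `wind_zpow`,
`wind_circleLoop_sub_of_norm_lt`), `wind (g ∘ γ) = 0` because `g` has a continuous logarithm on
the closed disc (homotopy lifting, `HasLogOn.of_homotopy`), and a zero `η₀` inside lies in `S`
with `n η₀ ≥ 1` (`wind_eq_sum`). This is the last step of the similarity principle
(`Literature/Analysis/Complex/SimilarityPrinciple.lean`).

Provenance: first written for the crux `TameOrBrodyR4` of summit `SmoothPoincare4`
(`Theorems/SullivanDualTameOrBrodyR4HelperWindNeZeroOfZero.lean`), re-homed here as general complex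
analysis (promotion event 3639839), with the positivity and centred forms added.

## References

* J. B. Conway, *Functions of One Complex Variable I*, 2nd ed. (1978), Ch. V §3 (argument
  principle). [Conway1978]
-/

noncomputable section

open Set Metric Filter
open scoped Topology
open Literature.Topology.PlaneTopology

namespace Literature.Analysis.Complex

namespace ArgPrinciple

/-- Every point of the circle `‖u‖ = r` (`r > 0`) is `circleLoop 0 r t` for some `t ∈ [0, 1]`. [folklore] -/
theorem exists_circleLoop_eq {r : ℝ} (hr : 0 < r) {u : ℂ} (hu : ‖u‖ = r) :
    ∃ t ∈ Icc (0 : ℝ) 1, circleLoop 0 r t = u := by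
  have hu' : u ∈ Metric.sphere (0 : ℂ) |r| := by simp [abs_of_pos hr, hu]
  rw [← image_circleMap_Ioc] at hu'
  obtain ⟨θ, hθ, hθu⟩ := hu'
  refine ⟨θ / (2 * Real.pi), ⟨div_nonneg hθ.1.le Real.two_pi_pos.le, ?_⟩, ?_⟩
  · rw [div_le_one Real.two_pi_pos]
    exact hθ.2
  · rw [← hθu]
    show circleMap 0 r (2 * Real.pi * (θ / (2 * Real.pi))) = circleMap 0 r θ
    rw [mul_div_cancel₀ θ (ne_of_gt Real.two_pi_pos)]

/-- Winding numbers of finite products of loops in `ℂ \ {0}` add up. [folklore] -/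
theorem wind_finset_prod {ι : Type*} (s : Finset ι) (f : ι → ℝ → ℂ)
    (hf : ∀ i ∈ s, IsNonvanishingLoop (f i)) :
    IsNonvanishingLoop (fun t => ∏ i ∈ s, f i t) ∧
      wind (fun t => ∏ i ∈ s, f i t) = ∑ i ∈ s, wind (f i) := by
  classical
  induction s using Finset.induction_on with
  | empty =>
    exact ⟨by simpa using IsNonvanishingLoop.const one_ne_zero, by simpa using wind_const 1⟩
  | insert a s ha ih =>
    obtain ⟨hl, hw⟩ := ih fun i hi => hf i (Finset.mem_insert_of_mem hi)
    have hfa := hf a (Finset.mem_insert_self a s)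
    refine ⟨?_, ?_⟩
    · simpa only [Finset.prod_insert ha] using hfa.mul hl
    · rw [Finset.sum_insert ha, ← hw, ← wind_mul hfa hl]
      exact wind_congr fun t _ => Finset.prod_insert ha

/-- A continuous zero-free map on a closed disc about `0` has a continuous logarithm there
(radial homotopy to a constant and homotopy lifting). [folklore] -/
theorem hasLogOn_closedBall {g : ℂ → ℂ} {r : ℝ} (hg : ContinuousOn g (closedBall 0 r))
    (hne : ∀ z ∈ closedBall (0 : ℂ) r, g z ≠ 0) : HasLogOn g (closedBall (0 : ℂ) r) := by
  rcases lt_or_ge r 0 with hr | hr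
  · rw [closedBall_eq_empty.2 hr]
    exact hasLogOn_empty g
  have hmem : ∀ t ∈ Icc (0 : ℝ) 1, ∀ z ∈ closedBall (0 : ℂ) r,
      (t : ℂ) * z ∈ closedBall (0 : ℂ) r := by
    intro t ht z hz
    rw [mem_closedBall_zero_iff] at hz ⊢
    rw [norm_mul, Complex.norm_of_nonneg ht.1]
    nlinarith [ht.1, ht.2, norm_nonneg z]
  have hmaps : MapsTo (fun p : ℝ × ℂ => (p.1 : ℂ) * p.2) (Icc 0 1 ×ˢ closedBall (0 : ℂ) r)
      (closedBall (0 : ℂ) r) := fun p hp => hmem p.1 hp.1 p.2 hp.2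
  have hcont : ContinuousOn (fun p : ℝ × ℂ => g ((p.1 : ℂ) * p.2))
      (Icc 0 1 ×ˢ closedBall (0 : ℂ) r) := hg.comp (by fun_prop) hmaps
  refine HasLogOn.of_homotopy (f := fun _ => g 0) (fun t z => g ((t : ℂ) * z)) hcont
    (fun z _ => by simp) (fun z _ => by simp) (fun t ht z hz => hne _ (hmem t ht z hz))
    (hasLogOn_const (hne 0 (mem_closedBall_self hr)) _)

/-- **Dividing out the zeros in the closed disc.** If `H` is holomorphic on `‖z‖ < ρ` and has no
zero on the circle `‖z‖ = r` (`0 < r < ρ`), then on `‖z‖ ≤ r` one has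
`H z = (∏_{u ∈ S} (z - u)^{n u}) · g z` with `S` a finite set of points of the open disc
`‖z‖ < r`, exponents `n u ≥ 1`, and `g` continuous and zero-free on `‖z‖ ≤ r`. [folklore] -/
theorem factorisation (H : ℂ → ℂ) {ρ r : ℝ} (hr : 0 < r) (hrρ : r < ρ)
    (hH : DifferentiableOn ℂ H (ball 0 ρ)) (hsph : ∀ u : ℂ, ‖u‖ = r → H u ≠ 0) :
    ∃ (S : Finset ℂ) (n : ℂ → ℕ) (g : ℂ → ℂ),
      (∀ u ∈ S, ‖u‖ < r ∧ 1 ≤ n u) ∧ ContinuousOn g (closedBall 0 r) ∧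
      (∀ z ∈ closedBall (0 : ℂ) r, g z ≠ 0) ∧
      ∀ z ∈ closedBall (0 : ℂ) r, H z = (∏ u ∈ S, (z - u) ^ n u) * g z := by
  classical
  set U := closedBall (0 : ℂ) r with hU
  have hUρ : U ⊆ ball 0 ρ := closedBall_subset_ball hrρ
  have hHan : AnalyticOnNhd ℂ H U := (hH.analyticOnNhd isOpen_ball).mono hUρ
  have hr_mem : ((r : ℝ) : ℂ) ∈ U := by
    rw [hU, mem_closedBall_zero_iff, Complex.norm_of_nonneg hr.le]
  have hHr : H (r : ℂ) ≠ 0 := hsph _ (Complex.norm_of_nonneg hr.le)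
  -- finite orders on the preconnected set `U`
  have hord : ∀ u : U, meromorphicOrderAt H u ≠ ⊤ := by
    intro u htop
    rw [(hHan u u.2).meromorphicOrderAt_eq] at htop
    have htop' : analyticOrderAt H u = ⊤ := by
      cases h : analyticOrderAt H u with
      | top => rfl
      | coe m => rw [h] at htop; simp at htop
    exact hHr (hHan.eqOn_zero_of_preconnected_of_eventuallyEq_zero
      (convex_closedBall (0 : ℂ) r).isPreconnected u.2 (analyticOrderAt_eq_top.mp htop') hr_mem)
  -- the divisor and the extraction of zeros
  set D := MeromorphicOn.divisor H U with hD
  have hD0 : ∀ u, 0 ≤ D u := fun u => MeromorphicOn.AnalyticOnNhd.divisor_nonneg hHan u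
  have hfin : D.support.Finite := D.finiteSupport (isCompact_closedBall 0 r)
  obtain ⟨g, hg_an, hg_ne, hfg⟩ := hHan.meromorphicOn.extract_zeros_poles hord hfin
  set S := hfin.toFinset with hS
  set n : ℂ → ℕ := fun u => (D u).toNat with hn
  set P : ℂ → ℂ := fun z => ∏ u ∈ S, (z - u) ^ n u with hP
  have hPeq : ∀ z, P z = (∏ᶠ u, (· - u) ^ (D u)) z := by
    intro z
    rw [Function.FactorizedRational.finprod_eq_fun hfin]
    simp only [hP]
    rw [finprod_eq_prod_of_mulSupport_subset _ (s := S)]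
    · refine Finset.prod_congr rfl fun u _ => ?_
      conv_rhs => rw [← Int.toNat_of_nonneg (hD0 u), zpow_natCast]
    · intro u hu
      rw [Function.mem_mulSupport] at hu
      simp only [hS, Finite.coe_toFinset, Function.mem_support, ne_eq]
      intro h
      exact hu (by rw [h, zpow_zero])
  have hPan : ∀ z, AnalyticAt ℂ P z := fun z => by
    apply Differentiable.analyticAt (f := P)
    simp only [hP]
    fun_prop
  -- `H = P g` near every point of `U`, hence on `U`
  have hperf : Preperfect U :=
    (convex_closedBall (0 : ℂ) r).isPreconnected.preperfect_of_nontrivial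
      ⟨(r : ℂ), hr_mem, 0, mem_closedBall_self hr.le, by exact_mod_cast hr.ne'⟩
  have hPg_an : ∀ x ∈ U, AnalyticAt ℂ (fun z => P z * g z) x := fun x hx =>
    (hPan x).mul (hg_an x hx)
  have hfg' : H =ᶠ[codiscreteWithin U] fun z => P z * g z := by
    filter_upwards [hfg] with z hz
    rw [hz, Pi.smul_apply', smul_eq_mul, hPeq]
  have hloc : ∀ x ∈ U, H x = P x * g x := by
    intro x hx
    have h1 := (hHan x hx).meromorphicAt.eventuallyEq_nhdsNE_of_eventuallyEq_codiscreteWithin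
      (hPg_an x hx).meromorphicAt hx (hperf x hx) hfg'
    exact (((hHan x hx).frequently_eq_iff_eventually_eq (hPg_an x hx)).mp
      h1.frequently).self_of_nhds
  refine ⟨S, n, g, ?_, hg_an.continuousOn, fun z hz => hg_ne ⟨z, hz⟩, hloc⟩
  -- support points are zeros of `H`, hence inside the open disc
  intro u hu
  have hu' : D u ≠ 0 := by simpa [hS] using hu
  have hn1 : 1 ≤ n u := by
    show 1 ≤ (D u).toNat
    have := hD0 u
    omega
  have huU : u ∈ U := D.supportWithinDomain (Function.mem_support.2 hu')
  refine ⟨lt_of_le_of_ne (mem_closedBall_zero_iff.mp huU) fun heq => hsph u heq ?_, hn1⟩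
  rw [hloc u huU]
  have hPu : P u = 0 := by
    simp only [hP]
    exact Finset.prod_eq_zero hu (by rw [sub_self, zero_pow (Nat.one_le_iff_ne_zero.mp hn1)])
  rw [hPu, zero_mul]

/-- **Counting the winding number.** If `H z = (∏_{u ∈ S} (z - u)^{n u}) · g z` on `‖z‖ ≤ r` with
`S` inside the open disc and `g` continuous and zero-free on the closed disc, then the winding
number of `H` along the circle `‖z‖ = r` is `∑_{u ∈ S} n u`. [folklore] -/
theorem wind_eq_sum {H g : ℂ → ℂ} {r : ℝ} (hr : 0 < r) (S : Finset ℂ) (n : ℂ → ℕ)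
    (hS : ∀ u ∈ S, ‖u‖ < r) (hg : ContinuousOn g (closedBall 0 r))
    (hg0 : ∀ z ∈ closedBall (0 : ℂ) r, g z ≠ 0)
    (hH : ∀ z ∈ closedBall (0 : ℂ) r, H z = (∏ u ∈ S, (z - u) ^ n u) * g z) :
    wind (fun t => H (circleLoop 0 r t)) = ∑ u ∈ S, (n u : ℤ) := by
  have hγ : ∀ t, circleLoop 0 r t ∈ closedBall (0 : ℂ) r := fun t =>
    sphere_subset_closedBall (circleLoop_mem_sphere 0 hr.le t)
  rw [wind_congr (g := fun t => (∏ u ∈ S, (circleLoop 0 r t - u) ^ n u) * g (circleLoop 0 r t))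
    (fun t _ => hH _ (hγ t))]
  -- the factor loops
  have hfac : ∀ u ∈ S, IsNonvanishingLoop (fun t => (circleLoop 0 r t - u) ^ n u) ∧
      wind (fun t => (circleLoop 0 r t - u) ^ n u) = n u := by
    intro u hu
    have hbase : IsNonvanishingLoop (fun t => circleLoop 0 r t - u) := by
      have h := isNonvanishingLoop_circleLoop (c := -u) (R := r) (by
        rw [norm_neg, abs_of_pos hr]
        exact (hS u hu).ne)
      exact h.congr fun t _ => by rw [circleLoop_sub, zero_sub]
    have he : EqOn (fun t => (circleLoop 0 r t - u) ^ (n u : ℤ))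
        (fun t => (circleLoop 0 r t - u) ^ n u) (Icc 0 1) := fun t _ => zpow_natCast _ _
    refine ⟨(hbase.zpow (n u)).congr he, ?_⟩
    rw [← wind_congr he, wind_zpow hbase, wind_circleLoop_sub_of_norm_lt (by simpa using hS u hu),
      mul_one]
  obtain ⟨hPl, hPw⟩ :=
    wind_finset_prod S (fun u t => (circleLoop 0 r t - u) ^ n u) fun u hu => (hfac u hu).1
  have hgl : IsNonvanishingLoop (fun t => g (circleLoop 0 r t)) :=
    ⟨hg.comp (continuous_circleLoop 0 r).continuousOn fun t _ => hγ t, fun t _ => hg0 _ (hγ t),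
      by rw [circleLoop_zero_eq]⟩
  have hgw : wind (fun t => g (circleLoop 0 r t)) = 0 :=
    wind_comp_eq_zero_of_hasLogOn (hasLogOn_closedBall hg hg0)
      (continuous_circleLoop 0 r).continuousOn (fun t _ => hγ t) (circleLoop_zero_eq 0 r)
  rw [wind_mul hPl hgl, hPw, hgw, add_zero]
  exact Finset.sum_congr rfl fun u hu => (hfac u hu).2

end ArgPrinciple

open ArgPrinciple

/-- **Argument principle, winding form: non-negativity.** If `H` is holomorphic on `‖z‖ < ρ` and
has no zero on the circle `‖z‖ = r` (`0 < r < ρ`), then the winding number of `H` along that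
circle is the total multiplicity of the zeros inside, hence `≥ 0`.
[cite: Conway1978, Ch. V Thm 3.4 (argument principle)] -/
theorem wind_circleLoop_nonneg (H : ℂ → ℂ) {ρ r : ℝ} (hr : 0 < r) (hrρ : r < ρ)
    (hH : DifferentiableOn ℂ H (ball 0 ρ)) (hsph : ∀ u : ℂ, ‖u‖ = r → H u ≠ 0) :
    0 ≤ wind (fun t => H (circleLoop 0 r t)) := by
  classical
  obtain ⟨S, n, g, hS, hg, hg0, hHPg⟩ := factorisation H hr hrρ hH hsph
  rw [wind_eq_sum hr S n (fun u hu => (hS u hu).1) hg hg0 hHPg]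
  exact Finset.sum_nonneg fun u _ => by positivity

/-- **Argument principle, winding form: positivity at a zero.** If `H` is holomorphic on
`‖z‖ < ρ`, vanishes at some `η₀` with `‖η₀‖ < r < ρ`, and has no zero on the circle `‖z‖ = r`,
then its winding number along that circle is `> 0` (it is the total multiplicity of the zeros
inside, and `η₀` contributes `≥ 1`). [cite: Conway1978, Ch. V Thm 3.4 (argument principle)] -/
theorem wind_circleLoop_pos_of_zero (H : ℂ → ℂ) {ρ r : ℝ} (hr : 0 < r) (hrρ : r < ρ)
    (hH : DifferentiableOn ℂ H (ball 0 ρ)) {η₀ : ℂ} (hη₀ : ‖η₀‖ < r) (hz : H η₀ = 0)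
    (hsph : ∀ u : ℂ, ‖u‖ = r → H u ≠ 0) :
    0 < wind (fun t => H (circleLoop 0 r t)) := by
  classical
  obtain ⟨S, n, g, hS, hg, hg0, hHPg⟩ := factorisation H hr hrρ hH hsph
  rw [wind_eq_sum hr S n (fun u hu => (hS u hu).1) hg hg0 hHPg]
  -- the zero `η₀` forces `η₀`'s factor to vanish: some `u ∈ S` with `n u ≥ 1`
  have hη₀U : η₀ ∈ closedBall (0 : ℂ) r := mem_closedBall_zero_iff.mpr hη₀.le
  have hP0 : ∏ u ∈ S, (η₀ - u) ^ n u = 0 := by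
    have h := hHPg η₀ hη₀U
    rw [hz] at h
    exact (mul_eq_zero.mp h.symm).resolve_right (hg0 η₀ hη₀U)
  obtain ⟨u, huS, -⟩ := Finset.prod_eq_zero_iff.mp hP0
  have h1 : 1 ≤ n u := (hS u huS).2
  have hle : (n u : ℤ) ≤ ∑ v ∈ S, (n v : ℤ) :=
    Finset.single_le_sum (f := fun v => (n v : ℤ)) (fun v _ => by positivity) huS
  omega

/-- **Argument principle, inequality form** (loop-parametrised hypothesis): a holomorphic function
with a zero inside a circle on which it does not vanish has non-zero winding number along that
circle. [cite: Conway1978, Ch. V Thm 3.4 (argument principle)] -/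
theorem wind_circleLoop_ne_zero_of_zero (H : ℂ → ℂ) {ρ r : ℝ} (hr : 0 < r) (hrρ : r < ρ)
    (hH : DifferentiableOn ℂ H (ball 0 ρ)) {η₀ : ℂ} (hη₀ : ‖η₀‖ < r) (hz : H η₀ = 0)
    (hne : ∀ t ∈ Icc (0 : ℝ) 1, H (circleLoop 0 r t) ≠ 0) :
    wind (fun t => H (circleLoop 0 r t)) ≠ 0 := by
  have hsph : ∀ u : ℂ, ‖u‖ = r → H u ≠ 0 := fun u hu => by
    obtain ⟨t, ht, htu⟩ := exists_circleLoop_eq hr hu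
    rw [← htu]
    exact hne t ht
  exact (wind_circleLoop_pos_of_zero H hr hrρ hH hη₀ hz hsph).ne'

/-- **Argument principle, winding form, circles centred at `z₀`.** If `H` is holomorphic on
`B(z₀, ρ)`, vanishes at `η₀ ∈ B(z₀, r)` (`0 < r < ρ`) and has no zero on the circle
`‖z - z₀‖ = r`, then `0 < wind (H ∘ circleLoop z₀ r)` (translate to the origin).
[cite: Conway1978, Ch. V Thm 3.4 (argument principle)] -/
theorem wind_circleLoop_pos_of_zero_of_center (H : ℂ → ℂ) {z₀ : ℂ} {ρ r : ℝ} (hr : 0 < r)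
    (hrρ : r < ρ) (hH : DifferentiableOn ℂ H (ball z₀ ρ)) {η₀ : ℂ} (hη₀ : ‖η₀ - z₀‖ < r)
    (hz : H η₀ = 0) (hsph : ∀ u : ℂ, ‖u - z₀‖ = r → H u ≠ 0) :
    0 < wind (fun t => H (circleLoop z₀ r t)) := by
  have key : ∀ t, circleLoop 0 r t + z₀ = circleLoop z₀ r t := fun t => by
    rw [circleLoop_apply, circleLoop_apply]
    ring
  have hH₀ : DifferentiableOn ℂ (fun z => H (z + z₀)) (ball 0 ρ) :=
    hH.comp (differentiableOn_id.add_const z₀) fun z hz => by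
      rw [mem_ball_zero_iff] at hz
      rwa [mem_ball, dist_eq_norm, add_sub_cancel_right]
  have h := wind_circleLoop_pos_of_zero (fun z => H (z + z₀)) hr hrρ hH₀ (η₀ := η₀ - z₀)
    (by simpa using hη₀) (by simpa using hz) (fun u hu => hsph (u + z₀) (by simpa using hu))
  simpa only [key] using h

end Literature.Analysis.Complex

end
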